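import Summits.Ventures.CertifiedArithmetic.LowPrec.GemmThetaLawGenDefs

/-!
# The E3M2×E3M2 all-precision law as `LawData`; level `top` checked

HONEST FRAMING (venture CertifiedArithmetic / cell `pub-lowprec`, seat gemm, gen 13): certified
error envelopes and provably optimal rounding/accumulation schemes for low-precision formats under
stated cost models; every table by two implementations; no hardware or vendor claims.

`e3m2Law` is the product alphabet E3M2×E3M2 (grid `2^-8`, 291 signed letters, `x_max = 200704`)
with the law of paper `gemm.tex` Theorem t:thetap6 (E3M2 row) in the symbolic regime `M =
65536·K`, `K ≥ 2`, i.e. EVERY `p ≥ 18`. The check `LawData.lawCheck` (42,200 classes, the design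
aid `symsplit_proto.py e3m2 17` count) is split by level over this file (`top`, side conditions)
and `GemmThetaLawGenE3M2Check1..N.lean`; `GemmThetaLawGenE3M2.lean` assembles `lawCheck_e3m2`.
Executable half of the certificate; `GemmThetaLawGenE3M2Cert.lean` reads it through the landed
soundness theorem `LawData.lawCheck_cert` (`GemmThetaLawGenCert.lean`).
-/

namespace Literature.ComputerArithmetic.FloatingPoint

namespace MiniFloat

namespace ThetaLaw

/-- E3M2×E3M2 products (grid `2^-8`) with the law of gemm.tex Thm t:thetap6 (E3M2 row): `B =
(2,3,4,5,6,8,11,17,29,53,101,197,389,773,1541,3077,6149,12293)`, `S =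
(2,2,2,2,4,6,12,24,48,96,192,384,768,1536,3072,6144,12288,24576)`, `J = 17`, `θ = (6149M +
12288)/65536 = 6149·2^(p-17) + 3/16`, `κ = 2^16/(6149·M + 12288)`, `ρ = 29/6`, `β_pair = 31/2`;
symbolic regime `M = 65536·K`, `K ≥ 2` (every `p ≥ 18`; regime floor `2M > x_max = 200704`).
[cell, laws.py] -/
def e3m2Law : LawData :=
  { X := [
      1, 2, 3, 4, 5, 6, 7, 8, 9, 10, 12, 14, 15, 16, 18, 20, 21, 24, 25, 28, 30, 32, 35, 36,
      40, 42, 48, 49, 50, 56, 60, 64, 70, 72, 80, 84, 96, 98, 100, 112, 120, 128, 140, 144,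
      160, 168, 192, 196, 200, 224, 240, 256, 280, 288, 320, 336, 384, 392, 400, 448, 480, 512,
      560, 576, 640, 672, 768, 784, 800, 896, 960, 1024, 1120, 1152, 1280, 1344, 1536, 1568,
      1600, 1792, 1920, 2048, 2240, 2304, 2560, 2688, 3072, 3136, 3200, 3584, 3840, 4096, 4480,
      4608, 5120, 5376, 6144, 6272, 6400, 7168, 7680, 8192, 8960, 9216, 10240, 10752, 12288,
      12544, 12800, 14336, 15360, 16384, 17920, 18432, 20480, 21504, 24576, 25088, 25600,
      28672, 30720, 32768, 35840, 36864, 40960, 43008, 49152, 50176, 51200, 57344, 61440,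
      65536, 71680, 73728, 81920, 86016, 98304, 100352, 102400, 114688, 122880, 143360, 147456,
      172032, 200704],
    J := 17,
    B := [2, 3, 4, 5, 6, 8, 11, 17, 29, 53, 101, 197, 389, 773, 1541, 3077, 6149, 12293],
    S := [2, 2, 2, 2, 4, 6, 12, 24, 48, 96, 192, 384, 768, 1536, 3072, 6144, 12288, 24576],
    th1 := 6149, th0 := 12288, thD := 65536, kb := 16, rhoN := 29, rhoD := 6, betaN := 31, betaD := 2,
    M0 := 65536, K0 := 2, fixed := false }

/-- Side conditions of the E3M2×E3M2 regime. [cell, kernel] -/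
theorem sideOK_e3m2 : e3m2Law.sideOK = true := by
  decide +kernel

/-- Level `top` of the E3M2×E3M2 law check passes (582 classes, both signs, all 291 letters).
[cell, kernel `decide`] -/
theorem levCheck_e3m2_top : e3m2Law.levCheck (Lev.top) = true := by
  decide +kernel

end ThetaLaw

end MiniFloat

end Literature.ComputerArithmetic.FloatingPoint
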